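import Summits.QuantumFields.YangMills.Theorems.BalabanUVNodesN07IterPlaquettesOfFineBoxPlaquettes
import Summits.QuantumFields.YangMills.Theorems.BalabanUVNodesPortS1JacKStepCore
import Literature.MathematicalPhysics.QuantumFieldTheory.Balaban1983to89.B8Eq191FlatLettersCubeMember
import Summits.QuantumFields.YangMills.Theorems.BalabanUVNodesPortS1JacKStepTowerLoops
import Literature.MathematicalPhysics.QuantumFieldTheory.Balaban1983to89.B13Inv214OrbitSUN
import Literature.Analysis.Calculus.ExpDuhamel
import Literature.NumberTheory.Sieve.CoprimeSquarefreeSumsBounds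
import Summits.QuantumFields.YangMills.Theorems.BalabanUVNodesN12FlatHndRecordLetters

/-!
# NODE O port PT-A — GEOMETRY OF THE TOWER REGION AS A NON-WRAPPING TWO-BLOCK COVER BOX, `SU(2)` CONJUGATION AND SMALL EXPONENTIALS (the lemmas of the proof of `JacKStep F`, companion
# `…JacKStepProof`)

Cell `ym-nodeO-ideate`, porter seat `ymgap-nodeO-port-PTA-1` (gen 6); proof file, `--supports stmt-QuantumFields-27930`.  [I] = [Balaban1987RG1], [6] = [Balaban1985RegularSpaces].
CONTENTS (theorems only; `M₂(ℂ)` with the `L²`-operator norm).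
* §1 GEOMETRY: the tower region `B^{k+1} ⁻¹' {c₋, c₊}` of a level-`(k+1)` bond is the image of the two-block box `[L^{k+1}t, L^{k+1}(t + e_{dir}) + (L^{k+1} − 1)]` of the cover (`t` = the
  val-lift of `c₋`), non-wrapping for `k + 2 ≤ m + K`: `Summit.QuantumFields.YangMills.BalabanUVNodes.N12FlatHndRecordLetters.blockIter_eq_iterBlockOf`, `src_eq_castSite_valLift`, `tgt_eq_castSite_valLift_add_e`, `iterBlockOf_cover_of_mem_twoBox`,
  `mem_image_twoBox_of_mem_towerRegion`, `twoBox_nonwrapping`, `twoBox_side_le`, ★ `bondsIn_towerRegion_subset_boxBonds`, ★ `boxPlaqs_twoBox_subset_plaqInside` (dag-n07-e's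
  `N07IterPlaquettesOfFineBoxPlaquettes` ∕ `N07ShearSizeTopBox` ∕ `N07SplitClauseBoxesCubeDomains` plumbing, composed).
* §2 `norm_mul_mul_adjugate_sub_one_le` (`‖g N g^adj − 1‖ ≤ ‖N − 1‖`, `g ∈ SU(2)`), `norm_exp_I_smul_sub_one_le` (`‖e^{iξA} − 1‖ ≤ 2ξ‖A‖` for `ξ‖A‖ ≤ 1`).

HONEST FRAMING.  Lattice∕algebra bookkeeping over landed theorems; NOTHING of Bałaban asserted or re-proved; 27930 OPEN · no claim; K0⁷∕K-Ax OPEN; NODE O 0∕1; COUNT 8∕28 · K 1∕4 UNMOVED; finite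
`𝕋⁴_{L^K}` at fixed ε — NOT continuum ∕ OS ∕ Clay; **the Yang–Mills mass gap is NOT proved by any of this.**  No `sorry`, no `def`, no `instance`, no `notation`; standard axioms.
-/

noncomputable section

open scoped BigOperators Matrix.Norms.L2Operator Topology

namespace Summit.QuantumFields.YangMills.Theorems.BalabanUVNodesPortS1

open Summit.QuantumFields.YangMills.Theorems.K0RecordFormatNames
open Literature.MathematicalPhysics.QuantumFieldTheory.Balaban1983to89
open Literature.MathematicalPhysics.QuantumFieldTheory.Balaban1983to89.Node00
open Literature.MathematicalPhysics.QuantumFieldTheory.Balaban1983to89.T4Continuum (T4Family)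
open Literature.MathematicalPhysics.QuantumFieldTheory.Balaban1983to89.B10Eq42TorusConstraint (bondsIn mem_bondsIn_iff)
open Literature.MathematicalPhysics.QuantumFieldTheory.Balaban1983to89.T4AxialGaugeSmallField (castSite castSite_apply castSite_add_e boxBonds boxPlaqs)
open Literature.MathematicalPhysics.QuantumFieldTheory.Balaban1983to89.B5Eq118OneStroke (iterBlockOf iterBlockOf_succ iterBlockOf_zero iterBlock mem_iterBlock)
open Literature.MathematicalPhysics.QuantumFieldTheory.Balaban1983to89.B7Prop1Explicit (e e_apply)
open Literature.MathematicalPhysics.QuantumFieldTheory.Balaban1983to89.B14DomainGeom (Pt)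
open Literature.MathematicalPhysics.QuantumFieldTheory.Balaban1983to89.B15Eq112TorusCover (cover)
open Literature.MathematicalPhysics.QuantumLattice (blockMap blockSites mem_blockSites_iff)
open Summit.QuantumFields.YangMills.BalabanUVNodes.N07IterPlaquettesOfFineBoxPlaquettes (mem_fineBox_of_iterBlockOf_eq)
open Summit.QuantumFields.YangMills.BalabanUVNodes.N07ShearSizeTopBox (mem_boxBonds_of_ends_mem_box)
open Literature.MathematicalPhysics.QuantumFieldTheory.Balaban1983to89.BlockAveraging (Idx)
open Literature.MathematicalPhysics.QuantumFieldTheory.Balaban1983to89.B15AveragingHolomorphic (loopMh iterMh)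
open _root_.Matrix

variable {P : Params}

/-! ## §1  Geometry: the tower region of a coarse bond is the image of a non-wrapping two-block box of the cover -/

/-- The source of a coarse bond is the projection of its val-lift. [cite: Balaban1987RG1, (0.1) p.251 (bookkeeping)] -/
theorem src_eq_castSite_valLift {j : ℕ} (c : PBond P j) : c.src = (castSite (fun κ => ((c.src κ).val : ℤ)) : Site P j) :=
  (coverAt_valLift j c.src).symm

/-- The target of a coarse bond is the projection of its val-lift shifted by `e_{dir}`. [cite: Balaban1987RG1, (0.1) p.251 (bookkeeping)] -/
theorem tgt_eq_castSite_valLift_add_e {j : ℕ} (c : PBond P j) :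
    c.tgt = (castSite ((fun κ => ((c.src κ).val : ℤ)) + e c.dir) : Site P j) := by
  rw [castSite_add_e, ← src_eq_castSite_valLift]; rfl

/-- A cover point of the two-block box `[L^{k+1}t, L^{k+1}(t + e_μ) + (L^{k+1} − 1)]` projects into one of the two `(k+1)`-blocks `castSite t`, `castSite (t + e_μ)`.
[cite: Balaban1987RG1, (0.1) p.251; Balaban1985RegularSpaces, (1.4) p.77 (bookkeeping)] -/
theorem iterBlockOf_cover_of_mem_twoBox {k : ℕ} (hk : k + 1 ≤ P.m + P.K) (t : Pt P.d) (μ : Fin P.d) {X : Pt P.d}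
    (hlo : (fun i => (P.L : ℤ) ^ (k + 1) * t i) ≤ X) (hhi : X ≤ fun i => (P.L : ℤ) ^ (k + 1) * (t + e μ) i + ((P.L : ℤ) ^ (k + 1) - 1)) :
    iterBlockOf (k + 1) (cover P X) = (castSite t : Site P (k + 1)) ∨ iterBlockOf (k + 1) (cover P X) = (castSite (t + e μ) : Site P (k + 1)) := by
  haveI : NeZero (P.L ^ (k + 1)) := ⟨(pow_pos P.L_pos _).ne'⟩
  have hL1 : 1 ≤ P.L := P.L_pos
  have hs0 : (0 : ℤ) < (P.L : ℤ) ^ (k + 1) := by positivity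
  -- the block label of `X`
  have key : ∀ y : Pt P.d, B8Ineq132.Under P.L (k + 1) y X → iterBlockOf (k + 1) (cover P X) = (castSite y : Site P (k + 1)) := by
    intro y hy
    have hbm : blockMap (P.L ^ (k + 1)) X = y := (B8Eq191FlatLettersCubeMember.under_iff_blockMap_eq hL1 (k + 1) y X).1 hy
    have hmem : cover P X ∈ (blockSites (P.L ^ (k + 1)) y).image (cover P) :=
      Finset.mem_image.2 ⟨X, (mem_blockSites_iff _ _ _).2 hbm, rfl⟩
    rw [image_cover_blockSites hk y, mem_iterBlock] at hmem
    exact hmem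
  by_cases hX : X μ < (P.L : ℤ) ^ (k + 1) * (t μ + 1)
  · left
    refine key t fun i => ?_
    have h1 := hlo i; have h2 := hhi i
    simp only [Pi.add_apply, e_apply] at h1 h2
    by_cases hi : i = μ
    · subst hi; exact ⟨h1, by linarith⟩
    · rw [if_neg hi] at h2
      exact ⟨h1, by linarith⟩
  · right
    have hX' : (P.L : ℤ) ^ (k + 1) * (t μ + 1) ≤ X μ := not_lt.1 hX
    refine key (t + e μ) fun i => ?_
    have h1 := hlo i; have h2 := hhi i
    simp only [Pi.add_apply, e_apply] at h1 h2 ⊢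
    by_cases hi : i = μ
    · subst hi
      rw [if_pos rfl] at h2 ⊢
      exact ⟨by linarith, by linarith⟩
    · rw [if_neg hi] at h2 ⊢
      exact ⟨by linarith, by linarith⟩

/-- A site of the tower region of `c` lies in the image of the two-block box under `c`. [cite: Balaban1987RG1, (0.1) p.251; Balaban1985RegularSpaces, (1.4) p.77 (bookkeeping)] -/
theorem mem_image_twoBox_of_mem_towerRegion {k : ℕ} (hk : k + 1 ≤ P.m + P.K) (c : PBond P (k + 1)) {x : Site P 0}
    (hx : x ∈ B14.Eq22Determines.blockIter (k + 1) ⁻¹' ({c.src, c.tgt} : Set (Site P (k + 1)))) :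
    x ∈ (castSite '' Set.Icc (fun i => (P.L : ℤ) ^ (k + 1) * (fun κ => ((c.src κ).val : ℤ)) i)
      (fun i => (P.L : ℤ) ^ (k + 1) * ((fun κ => ((c.src κ).val : ℤ)) + e c.dir) i + ((P.L : ℤ) ^ (k + 1) - 1)) : Set (Site P 0)) := by
  set t : Pt P.d := fun κ => ((c.src κ).val : ℤ) with ht
  have hs0 : (0 : ℤ) ≤ (P.L : ℤ) ^ (k + 1) := by positivity
  have htt : ∀ i, t i ≤ (t + e c.dir) i := fun i => by
    simp only [Pi.add_apply, e_apply]; split_ifs <;> linarith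
  rw [Set.mem_preimage, Set.mem_insert_iff, Set.mem_singleton_iff, Summit.QuantumFields.YangMills.BalabanUVNodes.N12FlatHndRecordLetters.blockIter_eq_iterBlockOf] at hx
  rcases hx with h | h
  · rw [src_eq_castSite_valLift c] at h
    obtain ⟨X, ⟨h1, h2⟩, hX⟩ := mem_fineBox_of_iterBlockOf_eq hk t h
    refine ⟨X, ⟨h1, fun i => (h2 i).trans ?_⟩, hX⟩
    have := htt i
    nlinarith [hs0]
  · rw [tgt_eq_castSite_valLift_add_e c] at h
    obtain ⟨X, ⟨h1, h2⟩, hX⟩ := mem_fineBox_of_iterBlockOf_eq hk (t + e c.dir) h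
    refine ⟨X, ⟨fun i => le_trans ?_ (h1 i), h2⟩, hX⟩
    have := htt i
    nlinarith [hs0]

/-- The two-block box does not wrap (`2L^{k+1} < 2L^{m+K}` for `k + 2 ≤ m + K`). [cite: Balaban1987RG1, (0.1) p.251 (bookkeeping)] -/
theorem twoBox_nonwrapping {k : ℕ} (hk : k + 2 ≤ P.m + P.K) (t : Pt P.d) (μ : Fin P.d) :
    ∀ κ : Fin P.d, ((P.L : ℤ) ^ (k + 1) * (t + e μ) κ + ((P.L : ℤ) ^ (k + 1) - 1)) + 1 - (P.L : ℤ) ^ (k + 1) * t κ < (P.sitesPerDir 0 : ℤ) := by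
  intro κ
  have hL1 : 1 ≤ P.L := P.L_pos
  have hpow : P.L ^ (k + 1) < P.L ^ (P.m + P.K) := Nat.pow_lt_pow_right P.hL.2 (by omega)
  have hN : 2 * P.L ^ (k + 1) < P.sitesPerDir 0 := by
    rw [Params.sitesPerDir, Nat.sub_zero]; omega
  have hN' : 2 * ((P.L : ℤ) ^ (k + 1)) < (P.sitesPerDir 0 : ℤ) := by exact_mod_cast hN
  have he : (t + e μ) κ ≤ t κ + 1 := by simp only [Pi.add_apply, e_apply]; split_ifs <;> linarith
  have hs0 : (0 : ℤ) ≤ (P.L : ℤ) ^ (k + 1) := by positivity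
  nlinarith

/-- The two-block box has at most `2L^{k+1}` sites per direction. [cite: Balaban1987RG1, (0.1) p.251 (bookkeeping)] -/
theorem twoBox_side_le {k : ℕ} (t : Pt P.d) (μ : Fin P.d) :
    ∀ κ : Fin P.d, (P.L : ℤ) ^ (k + 1) * (t + e μ) κ + ((P.L : ℤ) ^ (k + 1) - 1) ≤ (P.L : ℤ) ^ (k + 1) * t κ + ((2 * P.L ^ (k + 1) - 1 : ℕ) : ℤ) := by
  intro κ
  have h1 : 1 ≤ P.L ^ (k + 1) := Nat.one_le_pow _ _ P.L_pos
  have hcast : ((2 * P.L ^ (k + 1) - 1 : ℕ) : ℤ) = 2 * (P.L : ℤ) ^ (k + 1) - 1 := by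
    rw [Nat.cast_sub (by omega)]; push_cast; ring
  have he : (t + e μ) κ ≤ t κ + 1 := by simp only [Pi.add_apply, e_apply]; split_ifs <;> linarith
  have hs0 : (0 : ℤ) ≤ (P.L : ℤ) ^ (k + 1) := by positivity
  rw [hcast]; nlinarith

/-- The fine bonds of the tower region are bonds of the two-block box. [cite: Balaban1987RG1, (0.1) p.251; Balaban1985RegularSpaces, (1.4) p.77 (bookkeeping)] -/
theorem bondsIn_towerRegion_subset_boxBonds {k : ℕ} (hk : k + 2 ≤ P.m + P.K) (c : PBond P (k + 1)) {b : PBond P 0}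
    (hb : b ∈ bondsIn 0 (B14.Eq22Determines.blockIter (k + 1) ⁻¹' ({c.src, c.tgt} : Set (Site P (k + 1))))) :
    b ∈ (boxBonds (fun i => (P.L : ℤ) ^ (k + 1) * (fun κ => ((c.src κ).val : ℤ)) i)
      (fun i => (P.L : ℤ) ^ (k + 1) * ((fun κ => ((c.src κ).val : ℤ)) + e c.dir) i + ((P.L : ℤ) ^ (k + 1) - 1)) : Set (PBond P 0)) := by
  have hk1 : k + 1 ≤ P.m + P.K := by omega
  obtain ⟨h1, h2⟩ := mem_bondsIn_iff.1 hb
  rw [B10Eq38TorusDomains.toFine_zero] at h1 h2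
  exact mem_boxBonds_of_ends_mem_box (twoBox_nonwrapping hk _ c.dir) (mem_image_twoBox_of_mem_towerRegion hk1 c h1)
    (mem_image_twoBox_of_mem_towerRegion hk1 c h2)

/-- The plaquettes of the two-block box are plaquettes inside the tower region. [cite: Balaban1987RG1, (0.1) p.251 (bookkeeping)] -/
theorem boxPlaqs_twoBox_subset_plaqInside {k : ℕ} (hk : k + 1 ≤ P.m + P.K) (c : PBond P (k + 1)) :
    (boxPlaqs (fun i => (P.L : ℤ) ^ (k + 1) * (fun κ => ((c.src κ).val : ℤ)) i)
        (fun i => (P.L : ℤ) ^ (k + 1) * ((fun κ => ((c.src κ).val : ℤ)) + e c.dir) i + ((P.L : ℤ) ^ (k + 1) - 1)) : Set (Plaq P 0)) ⊆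
      plaqInside (B14.Eq22Determines.blockIter (k + 1) ⁻¹' ({c.src, c.tgt} : Set (Site P (k + 1)))) := by
  intro p hp
  obtain ⟨z, hz1, hz2, hsrc⟩ := hp
  set t : Pt P.d := fun κ => ((c.src κ).val : ℤ) with ht
  -- every cover point of the box projects into the region
  have hin : ∀ X : Pt P.d, (fun i => (P.L : ℤ) ^ (k + 1) * t i) ≤ X → X ≤ (fun i => (P.L : ℤ) ^ (k + 1) * (t + e c.dir) i + ((P.L : ℤ) ^ (k + 1) - 1)) →
      cover P X ∈ B14.Eq22Determines.blockIter (k + 1) ⁻¹' ({c.src, c.tgt} : Set (Site P (k + 1))) := by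
    intro X hX1 hX2
    rw [Set.mem_preimage, Set.mem_insert_iff, Set.mem_singleton_iff, Summit.QuantumFields.YangMills.BalabanUVNodes.N12FlatHndRecordLetters.blockIter_eq_iterBlockOf, src_eq_castSite_valLift c,
      tgt_eq_castSite_valLift_add_e c]
    exact iterBlockOf_cover_of_mem_twoBox hk t c.dir hX1 hX2
  have hcov : ∀ X : Pt P.d, (castSite X : Site P 0) = cover P X := fun X => rfl
  have heμ : (0 : Pt P.d) ≤ e p.μ := fun i => by simp only [Pi.zero_apply, e_apply]; split_ifs <;> norm_num
  have heν : (0 : Pt P.d) ≤ e p.ν := fun i => by simp only [Pi.zero_apply, e_apply]; split_ifs <;> norm_num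
  have hz_le : z ≤ z + e p.μ + e p.ν := fun i => by have := heμ i; have := heν i; simp only [Pi.add_apply, Pi.zero_apply] at *; linarith
  refine ⟨?_, ?_, ?_, ?_⟩
  · rw [hsrc, hcov]; exact hin z hz1 (hz_le.trans hz2)
  · rw [hsrc, ← castSite_add_e, hcov]
    exact hin _ (hz1.trans fun i => by have := heμ i; simp only [Pi.add_apply, Pi.zero_apply] at *; linarith)
      (le_trans (fun i => by have := heν i; simp only [Pi.add_apply, Pi.zero_apply] at *; linarith) hz2)
  · rw [hsrc, ← castSite_add_e, hcov]
    exact hin _ (hz1.trans fun i => by have := heν i; simp only [Pi.add_apply, Pi.zero_apply] at *; linarith)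
      (le_trans (fun i => by have := heμ i; simp only [Pi.add_apply, Pi.zero_apply] at *; linarith) hz2)
  · rw [hsrc, ← castSite_add_e, ← castSite_add_e, hcov]; exact hin _ (hz1.trans hz_le) hz2


/-! ## §2  `SU(2)` conjugation, small exponentials -/

/-- `‖g N g^adj − 1‖ ≤ ‖N − 1‖` for `g ∈ SU(2)` (unitary conjugation is an isometry of `M₂(ℂ)`). [folklore] -/
theorem norm_mul_mul_adjugate_sub_one_le (g : MatA 2) (hg : g ∈ Matrix.specialUnitaryGroup (Fin 2) ℂ) (N : MatA 2) :
    ‖g * N * g.adjugate - 1‖ ≤ ‖N - 1‖ := by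
  have hdet : g.det = 1 := (Matrix.mem_specialUnitaryGroup_iff.1 hg).2
  have hU : g ∈ Matrix.unitaryGroup (Fin 2) ℂ := (Matrix.mem_specialUnitaryGroup_iff.1 hg).1
  have hga : g * g.adjugate = 1 := by rw [mul_adjugate, hdet, one_smul]
  have hstar : g.adjugate = star g := by
    calc g.adjugate = (star g * g) * g.adjugate := by rw [Matrix.mem_unitaryGroup_iff'.1 hU, one_mul]
      _ = star g := by rw [mul_assoc, hga, mul_one]
  have e1 : g * N * g.adjugate - 1 = g * ((N - 1) * g.adjugate) := by rw [sub_mul, one_mul, mul_sub, ← mul_assoc, hga]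
  rw [e1, CStarRing.norm_mem_unitary_mul _ hU, hstar, CStarRing.norm_mul_mem_unitary _ (Unitary.star_mem hU)]

/-- `‖exp((iξ)·A) − 1‖ ≤ 2ξ‖A‖` when `0 ≤ ξ`, `ξ‖A‖ ≤ 1`. [folklore] -/
theorem norm_exp_I_smul_sub_one_le {ξ : ℝ} (hξ : 0 ≤ ξ) (A : MatA 2) (h : ξ * ‖A‖ ≤ 1) :
    ‖NormedSpace.exp ((Complex.I * (ξ : ℂ)) • A) - 1‖ ≤ 2 * (ξ * ‖A‖) := by
  have hn : ‖(Complex.I * (ξ : ℂ)) • A‖ = ξ * ‖A‖ := by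
    rw [norm_smul, norm_mul, Complex.norm_I, one_mul, Complex.norm_real, Real.norm_of_nonneg hξ]
  calc ‖NormedSpace.exp ((Complex.I * (ξ : ℂ)) • A) - 1‖ ≤ Real.exp ‖(Complex.I * (ξ : ℂ)) • A‖ - 1 :=
        Literature.Analysis.Calculus.norm_exp_sub_one_le _
    _ ≤ 2 * (ξ * ‖A‖) := by rw [hn]; exact Literature.NumberTheory.Sieve.SquarefreeSums.exp_sub_one_le_two_mul (by positivity) h


end Summit.QuantumFields.YangMills.Theorems.BalabanUVNodesPortS1

end
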